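import Summits.AtomisticToContinuum.HydrodynamicLimit.Theorems.ImplosionDichotomyDiluteSelfConsistencySmoothReduction
import Literature.MathematicalPhysics.KineticTheory.IdealGasEulerLocalTheoryProofs

/-!
# Profiles with no ideal development are `DiluteSelfConsistency`-trivial (stub `stub_noIdealDevelopmentTrivial`)

Crux `Summit.AtomisticToContinuum.HydrodynamicLimit.Theses.ImplosionDichotomy.DiluteSelfConsistency`
(stmt-AtomisticToContinuum-3091; `Iff.rfl`-equal copy `Theses.ImplosionLoophole.DiluteSelfConsistency`),
line `birth` (rev c3), stub B.0 of the time split: for every level `η > 0` and all continuous positive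
profiles `(a₀, θ₀, u₀)` whose reference data `(a₀/∫a₀, u₀, θ₀)` launch NO ideal-gas (`σ = 0`) classical
solution on any nonempty `[0, T₁)`, there is `σ₀ > 0` with `DiluteSelfConsistencyHoldsAt η a₀ θ₀ u₀ σ₀`.

## Proof

Case on `Torus.IsSmooth a₀ ∧ Torus.IsSmooth θ₀ ∧ Torus.IsSmooth u₀`.

* All smooth: the reference density `β = a₀ / ∫ a₀` (`profileOf a₀`) is smooth, positive and bounded by
  `M = sup β`, so the tree's local well-posedness theorem for the complete Euler system of the monatomic
  ideal gas (`CompressibleEulerLocalWellPosedness_holds` with `ζ ≡ 1`, density ceiling `M + 1`) launches a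
  classical solution on some `[0, T)`, `T > 0`, which is a `σ = 0` hard-sphere Euler solution
  (`isHardSphereEulerSolution_zero_of_classical`) with the reference data — contradicting the hypothesis
  (`exists_idealDevelopment`).
* Not all smooth: the inner clause holds vacuously below the threshold of the landed smooth reduction
  (`DiluteSelfConsistencySmoothReduction.holdsAt_of_not_smooth`: data pinning `admissible_iff_data`, flow
  transfer `tendstoHydroFieldsAt_zero_transfer`, and `stub_nonsmoothVacuous`).

prover-line-stmt-AtomisticToContinuum-3091-c3-0 (line `birth`, rev c3; stub worker B.0).
-/

noncomputable section

namespace Summit.AtomisticToContinuum.HydrodynamicLimit.Theorems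

open MeasureTheory Filter Set Topology
open Literature.MathematicalPhysics.KineticTheory Literature.Analysis.FluidPDE Literature.Analysis.FunctionSpaces
open scoped ContDiff

namespace DiluteSelfConsistencyNoIdealDevelopment

/-- **Smooth positive profiles launch an ideal development.** For smooth `a₀, θ₀ : 𝕋³ → ℝ`, `u₀ : 𝕋³ → ℝ³`
with `a₀, θ₀ > 0` there is a classical ideal-gas (`σ = 0`) hard-sphere Euler solution on some nonempty
`[0, T₁)` with data `(a₀/∫a₀, u₀, θ₀)`: local well-posedness of the complete Euler system of the monatomic
ideal gas (`CompressibleEulerLocalWellPosedness_holds`, `ζ ≡ 1`, density ceiling `sup β + 1`) and the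
identification `isHardSphereEulerSolution_zero_of_classical`. [folklore] -/
theorem exists_idealDevelopment {a₀ θ₀ : T3 → ℝ} {u₀ : T3 → V3} (ha : Torus.IsSmooth a₀)
    (hθ : Torus.IsSmooth θ₀) (hu : Torus.IsSmooth u₀) (ha0 : ∀ x, 0 < a₀ x) (hθ0 : ∀ x, 0 < θ₀ x) :
    ∃ (T₁ : ℝ) (ρ₁ θ₁ : ℝ → T3 → ℝ) (u₁ : ℝ → T3 → V3), 0 < T₁ ∧ IsHardSphereEulerSolution 0 T₁ ρ₁ u₁ θ₁ ∧
      (∀ x, ρ₁ 0 x = a₀ x / ∫ y, a₀ y) ∧ u₁ 0 = u₀ ∧ θ₁ 0 = θ₀ := by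
  set P := profileOf a₀ ha.continuous ha0 with hP
  have hβ : Torus.IsSmooth P.β := by
    show ContDiff ℝ ∞ (Torus.lift P.β)
    have e : Torus.lift P.β = fun y => Torus.lift a₀ y / ∫ z, a₀ z := rfl
    rw [e]
    exact ha.div_const _
  obtain ⟨hloc, -⟩ := CompressibleEulerLocalWellPosedness_holds (fun _ => (1 : ℝ)) (fun _ => (0 : ℝ))
    (P.M + 1) contDiff_const (by linarith [P.M_pos]) (fun r _ => by simp)
  obtain ⟨T, hT, ρ, θ, u, hsol, hρ0, hu0, hθ0, -⟩ :=
    hloc P.β θ₀ u₀ hβ hθ hu P.pos (fun x => by linarith [P.le_M x]) hθ0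
  exact ⟨T, ρ, θ, u, hT, isHardSphereEulerSolution_zero_of_classical hsol, fun x => by rw [hρ0]; rfl,
    hu0, hθ0⟩

end DiluteSelfConsistencyNoIdealDevelopment

open DiluteSelfConsistencyNoIdealDevelopment (exists_idealDevelopment)
open DiluteSelfConsistencySmoothReduction (holdsAt_of_not_smooth)

/-- **Stub `stub_noIdealDevelopmentTrivial` (B.0 of the time split of `DiluteSelfConsistency`, line `birth`
rev c3): no ideal development ⇒ trivial.** For every level `η > 0` and all continuous positive profiles
`(a₀, θ₀, u₀)` whose reference data `(a₀/∫a₀, u₀, θ₀)` launch NO ideal-gas (`σ = 0`) classical solution on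
any nonempty `[0, T₁)`, there is `σ₀ > 0` with `DiluteSelfConsistencyHoldsAt η a₀ θ₀ u₀ σ₀`: smooth profiles
always have an ideal development (`exists_idealDevelopment`), so the profiles are not all smooth, and then
the inner clause holds vacuously (`DiluteSelfConsistencySmoothReduction.holdsAt_of_not_smooth`). [folklore] -/
theorem stub_noIdealDevelopmentTrivial :
    ∀ η : ℝ, 0 < η → ∀ (a₀ θ₀ : T3 → ℝ) (u₀ : T3 → V3), Continuous a₀ → Continuous θ₀ → Continuous u₀ →
      (∀ x, 0 < a₀ x) → (∀ x, 0 < θ₀ x) →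
      (¬ ∃ (T₁ : ℝ) (ρ₁ θ₁ : ℝ → T3 → ℝ) (u₁ : ℝ → T3 → V3), 0 < T₁ ∧ IsHardSphereEulerSolution 0 T₁ ρ₁ u₁ θ₁ ∧
          (∀ x, ρ₁ 0 x = a₀ x / ∫ y, a₀ y) ∧ u₁ 0 = u₀ ∧ θ₁ 0 = θ₀) →
      ∃ σ₀ : ℝ, 0 < σ₀ ∧ DiluteSelfConsistencyHoldsAt η a₀ θ₀ u₀ σ₀ := by
  intro η _ a₀ θ₀ u₀ ha hθ hu ha0 hθ0 hno
  by_cases hs : Torus.IsSmooth a₀ ∧ Torus.IsSmooth θ₀ ∧ Torus.IsSmooth u₀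
  · exact absurd (exists_idealDevelopment hs.1 hs.2.1 hs.2.2 ha0 hθ0) hno
  · exact holdsAt_of_not_smooth ha hθ hu ha0 hθ0 hs η

end Summit.AtomisticToContinuum.HydrodynamicLimit.Theorems

end
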